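import Literature.AlgebraicGeometry.Resolution.WeightedCentreTailedLightFlow
import HarnessLib

/-!
# Flow extraction: `X′ ≡ T (mod σ^p)` with `deg_σ X′(ε) ≤ p` means `X′ = Φ(T)` for the tail `q = [σ^p] X′(ε)`

Uniform value line: INSTRUMENT — kernel-checked bookkeeping for the polynomial weighted-centre model `W(f)` of the cell
(engine 1's toy model) — NOT a resolution theorem, NOT a statement about the Abramovich–Temkin–Włodarczyk invariant, NOT summit
progress; AI-written Lean, AI review is weaker than expert review.

CARVER-NOTES-eng1-g44 §1, T107 case `r = 1`, last sentence: once the CLIMB (`WeightedCentreEigenClimb`) in the truncated group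
has shown `X′ ≡ Ψ_𝔇(σ) (mod σ^p)` (and `Ψ_𝔇(σ)(ε_i) = T ε_i = Σ_{n<p} u_n 𝔇^n(ε_i) σ^n`,
`WeightedCentreTruncatedFlow.flowC_X_eq`), and the weight bound has cut `X′(ε_i)` off above `σ^p`, the automorphism `X′` is
LITERALLY the substitution
`Φ(σ) : ε_i ↦ Σ_{n<p} u_n 𝔇^n(ε_i) σ^n + q_i σ^p` of `WeightedCentreTailedLightFlow` (`TailedLightFlow.subst 𝔇 p u q`) with
`q_i :=` the `σ^p`-coefficient of `X′(ε_i)`.  This file records exactly that, for an arbitrary ring endomorphism `Φ` of `k[ε][σ]`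
fixing `σ` and the scalars:

* `eq_substC_X_of_X_pow_dvd` — one slot: `σ^p ∣ P − T ε_i` and `P` has no terms above `σ^p` ⇒ `P = Φ(σ)(ε_i)` with
  `q_i = [σ^p] P`;
* `eq_subst` — the endomorphism: `Φ σ = σ`, `Φ` fixes `k`, `σ^p ∣ Φ(ε_i) − T ε_i` and `[σ^n] Φ(ε_i) = 0` for `n > p`,
  all `i` ⇒ `Φ = TailedLightFlow.subst 𝔇 p u q`, `q_i := [σ^p] Φ(ε_i)`.

No hypothesis on `𝔇`, `p`, `u` or the characteristic is needed: this is coefficient bookkeeping ([Lang2002, Ch. IV §1]); the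
exponential series context is [Matsumura1987, §27].

Framing: an instrument for the cell's toy model; [Lang2002], [Matsumura1987] and [AbramovichTemkinWlodarczyk2024, §5.1] are cited
for context only.  Copyright: derived here (Resolution Observatory cell `pub-rosobs`, carver gen 64); AI-written Lean, AI review is
weaker than expert review.
-/

namespace Literature.AlgebraicGeometry.Resolution.WeightedBlowup

open Polynomial

namespace TailedLightFlow

section Extraction

variable {k : Type*} [CommRing k] {ι : Type*} (D : Derivation k (MvPolynomial ι k) (MvPolynomial ι k)) (p : ℕ) (u : ℕ → k)

/-- **One slot**: a polynomial `P ∈ k[ε][σ]` with `σ^p ∣ P − T ε_i` and no terms above `σ^p` is `Φ(σ)(ε_i)` for any tail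
vector `q` with `q_i = [σ^p] P` (derived here; coefficient bookkeeping).
[cite: Lang2002, Ch. IV §1] [cite: Matsumura1987, §27 (pp. 207–209)] -/
theorem eq_substC_X_of_X_pow_dvd {i : ι} {P : (MvPolynomial ι k)[X]} (hP : X ^ p ∣ P - sigmaExp D p u (MvPolynomial.X i))
    (hdeg : ∀ n, p < n → P.coeff n = 0) (q : ι → MvPolynomial ι k) (hq : q i = P.coeff p) :
    P = substC D p u q (MvPolynomial.X i) := by
  ext n
  rw [coeff_substC_X]
  rcases Nat.lt_trichotomy n p with hn | rfl | hn
  · have h0 := (Polynomial.X_pow_dvd_iff.mp hP) n hn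
    rw [coeff_sub, sub_eq_zero] at h0
    rw [if_pos hn, if_neg hn.ne, add_zero, h0, coeff_sigmaExp_X, if_pos hn]
  · rw [if_neg (lt_irrefl _), zero_add, if_pos rfl, hq]
  · rw [hdeg n hn, if_neg (by omega), if_neg (by omega), add_zero]

/-- **Flow extraction** (derived here; T107 case `r = 1`, last step): a ring endomorphism `Φ` of `k[ε][σ]` fixing `σ` and the
scalars, congruent to the truncated exponential on the generators modulo `σ^p` (`σ^p ∣ Φ(ε_i) − T ε_i`) and with no terms above
`σ^p` there, IS the substitution `Φ(σ)` of the tailed light flow `(𝔇, q)`, `q_i := [σ^p] Φ(ε_i)`.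
[cite: Lang2002, Ch. IV §1] [cite: Matsumura1987, §27 (pp. 207–209)] -/
theorem eq_subst {Φ : (MvPolynomial ι k)[X] →+* (MvPolynomial ι k)[X]} (hX : Φ X = X)
    (hC : ∀ c : k, Φ (C (MvPolynomial.C c)) = C (MvPolynomial.C c))
    (hcong : ∀ i, X ^ p ∣ Φ (C (MvPolynomial.X i)) - sigmaExp D p u (MvPolynomial.X i))
    (hdeg : ∀ i n, p < n → (Φ (C (MvPolynomial.X i))).coeff n = 0) :
    Φ = subst D p u (fun i => (Φ (C (MvPolynomial.X i))).coeff p) := by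
  refine Polynomial.ringHom_ext' (MvPolynomial.ringHom_ext (fun c => ?_) (fun i => ?_)) (by rw [hX, subst_X])
  · rw [RingHom.comp_apply, RingHom.comp_apply, hC, subst_C_C]
  · rw [RingHom.comp_apply, RingHom.comp_apply, subst_C]
    exact eq_substC_X_of_X_pow_dvd D p u (hcong i) (hdeg i) _ rfl

/-- Conversely (bookkeeping): `Φ(σ)` itself satisfies the congruence — `σ^p ∣ Φ(σ)(ε_i) − T ε_i`.
[cite: Matsumura1987, §27 (pp. 207–209)] -/
theorem X_pow_dvd_substC_X_sub (q : ι → MvPolynomial ι k) (i : ι) :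
    X ^ p ∣ substC D p u q (MvPolynomial.X i) - sigmaExp D p u (MvPolynomial.X i) :=
  ⟨C (q i), by rw [substC_X, add_sub_cancel_left, mul_comm]⟩

/-- … and has no terms above `σ^p` on the generators (bookkeeping). [cite: Matsumura1987, §27 (pp. 207–209)] -/
theorem coeff_substC_X_eq_zero_of_lt (q : ι → MvPolynomial ι k) (i : ι) {n : ℕ} (hn : p < n) :
    (substC D p u q (MvPolynomial.X i)).coeff n = 0 := by
  rw [coeff_substC_X, if_neg (by omega), if_neg (by omega), add_zero]

end Extraction

end TailedLightFlow

end Literature.AlgebraicGeometry.Resolution.WeightedBlowup
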